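import Literature.NumberTheory.EllipticCurves.Kato2004.IwasawaH2FineSelmerDualComparison
import Literature.NumberTheory.EllipticCurves.KatoFineSelmerDualUniquenessProofs
import Literature.NumberTheory.EllipticCurves.IwasawaAlgebraInvolutionFixedPrimesProofs
import Literature.NumberTheory.EllipticCurves.IwasawaAlgebraSemilinearCharIdealProofs
import Mathlib.RingTheory.Ideal.Height
import HarnessLib

/-!
# The Iwasawa-involution twist `M ↦ M^ι` of Kato's pinned packages: `IwasawaH2Data` (`𝐇²_Γ(T_pW)` with
# its descent sequence) and the dual fine Selmer datum `FineSelmerDualData κ γ ↦ FineSelmerDualData κ γ⁻¹`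
# — and the PRINT-EXACT (contragredient) form of the (H2)-lengths comparison (proofs only; 0 def, 0 fact)

Topic `NumberTheory/EllipticCurves`, sub-directory `Kato2004` (namespace = path). Cell `bsd-cm`, seat
`bsd-cm-prr-ty1` g6 (CONVENTION Q of planner D401/D403 on the Kato–Perrin-Riou skeletons of cruxes
stmt-BirchSwinnertonDyer-19945 / -19223). THEOREMS ONLY: no definition, no named fact, no `instance`, no notation,
no `sorry`; nothing about Kato's Main Conjecture or BSD is asserted.

## Why (the two `Λ`-conventions of the tree, read from the DEFINITIONS)

`Λ = ℤ_p⟦T⟧` acts on the tree's pinned Iwasawa cohomology `I : Kato2004.IwasawaH1Data W p κ γ` through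
`T = conj_γ − 1` (`IwasawaH1Data.proj_T_smul`), where `conj_σ` is the NATURAL (covariant, transport-of-structure)
action `(σ·c)(h) = σ • c(σ⁻¹ h σ)` on `H¹` (`GaloisRepresentations.conjMap`, `SubgroupSelmer.conjH1`): this is
Kato's `ℤ_p[[Gal(ℚ_∞/ℚ)]]`-structure on `𝐇¹(T) = lim H¹(ℤ[ζ_{p^n}][1/p], T)` with `1 + T ↦ γ` [Kato, §12.2 p. 220].
On a dual fine Selmer datum `Y : W.FineSelmerDualData κ γ` (`X₀ = Hom(Sel₀(K_∞, E[p^∞]), ℚ/ℤ)`) the tree lets `T`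
act by PRE-composition, `(T·x)(s) = x(conj_γ s) − x(s)` (`FineSelmerDualData.toDual_T_smul`), i.e. `1 + T` acts as
`x ↦ x ∘ conj_γ` = the CONTRAGREDIENT action `x ↦ x ∘ conj_{δ⁻¹}` of `δ = γ⁻¹`. Poitou–Tate duality being induced by
a Galois-INVARIANT pairing, it carries the natural action of `σ` on `𝐇²(T)` to `x ↦ x ∘ conj_{σ⁻¹}` on the
Pontryagin dual; so, with `1 + T ↦ γ` on both sides, Kato's `𝐇²(T_pW)₀` corresponds to the datum of key `γ⁻¹`,
`W.FineSelmerDualData κ γ⁻¹`, while the datum of key `γ` is its twist `(X₀)^ι` by the Iwasawa involution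
`ι : T ↦ (1 + T)⁻¹ − 1` (`IwasawaAlgebra.invol`) [Greenberg 1989, pp. 101–102: "`S^ι` … the `Λ`-module with the
same underlying set as `S` but with `Λ` acting through `ι`"; Greenberg LNM 1716 §1 p. 60]. This is the reading
established for Kato's Thm. 13.4 by cell `bsd-wall` (`Kato2004/EulerSystemBoundFineSelmerContragredient.lean`,
module docstring; convention audit `G4-CONVENTION-AUDIT.md` + second reader, 2026-08-28) and it applies verbatim to
the (H2) comparison «height-one lengths of `𝐇²_Γ(T_pW)` = those of `X₀(ℚ_∞)`» used by the closed Kato descent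
binders of `Summits/…/Rank1Residual/Additive/KatoDescentClosedBinders.lean`.

## What is proved (all for the NAMED involution `IwasawaAlgebra.invol p`)

* §1 algebra of `ι` on `Λ`-modules: `X_add_invol_X_add_mul` (`T + ιT + ιT·T = 0`), on `M[T]` the twisted and
  untwisted `T` kill the same elements (`invol_X_smul_eq_zero_iff`) and `ι f` acts as `f`
  (`invol_smul_eq_smul_of_X_smul_eq_zero`: the action on `M[T]` is through the augmentation, which `ι` preserves).
* §2 transport along an additive equivalence `e : M ≃+ N` with `e (f • m) = ι f • e m` («`N = M^ι`»):
  `Module.Finite`, `Module.IsTorsion`, and `ℓ_𝔓(N) = ℓ_{ι𝔓}(M)` (`lengthAt_eq_of_involSemilinear`, from the tree's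
  `Module.lengthAt_eq_of_semilinearEquiv`), `ι𝔓 := PrimeSpectrum.comap (invol p) 𝔓`, which has the height of `𝔓`.
* §3 **the `γ ↦ γ⁻¹` twist of a dual fine Selmer datum is its `ι`-twist** (Literature re-derivation, named-`ι`
  spelling, of `Summit…SignedKatoOffTwo.IwasawaInvolution.exists_twist_fineSelmerDualData_invol`, cell `bsd-wall`):
  `fineSelmerDualData_exists_involTwist` (`γ δ = 1 ⇒ ∃ Y' : W.FineSelmerDualData κ δ`, `e : Y.X ≃+ Y'.X`
  `ι`-semilinear over `toDual`) and `fineSelmerDualData_lengthAt_inv_eq` (**for ANY `Y : W.FineSelmerDualData κ γ`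
  and ANY `Y' : W.FineSelmerDualData κ γ⁻¹`: `ℓ_𝔓(Y'.X) = ℓ_{ι𝔓}(Y.X)`** — uniqueness at each key,
  `FineSelmerDualData.nonempty_linearEquiv`).
* §4 **the `ι`-twist of Kato's `𝐇²`-package**: `IwasawaH2Data.exists_involTwist` — for every
  `J : IwasawaH2Data W p κ γ I` there is `J' : IwasawaH2Data W p κ γ I` on the SAME `(A, toH1, ι)` with
  `J'.H2 = (J.H2)^ι` (an `ι`-semilinear `e : J.H2 ≃+ J'.H2`), hence `ℓ_𝔓(J'.H2) = ℓ_{ι𝔓}(J.H2)`; every axiom of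
  the package ((12.2.1) finiteness, Thm. 12.4 (1) torsion, the descent sequence (14.14.1) with its pins) is
  insensitive to the twist because `H2` enters (14.14.1) only through `H2[T]`, on which `Λ` acts through the
  augmentation.
* §5 **the print-exact form of the (H2)-lengths comparison**, DERIVED (0 new facts) from the named fact
  `Kato2004.exists_iwasawaH2Data_fineSelmerDual_embedding` (p624791, stated for the key-`γ` datum
  `W.fineSelmerDualData κ hγ`): `exists_iwasawaH2Data_fineSelmerDual_embedding.lengthAt_eq_contra` — under the
  fact's hypotheses, for every pinned `I` and EVERY `Y : W.FineSelmerDualData κ γ⁻¹` there is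
  `J : IwasawaH2Data W p κ γ I` with `ℓ_𝔮(J.H2) = ℓ_𝔮(Y.X)` at every height-one `𝔮` (take the fact's `J₁`, twist
  it by §4, and use §3: `ℓ_𝔮(J₁^ι) = ℓ_{ι𝔮}(J₁) = ℓ_{ι𝔮}((X₀)_γ) = ℓ_𝔮(Y)`). This is the (H2) clause of the
  closed `IsOf` in its contragredient (print-exact) keying.

References: K. Kato, Astérisque 295 (2004) §12.2 (p. 220), Thm. 12.4 (p. 221), (14.9.1) (p. 239), §14.14
(14.14.1) (p. 243), §17.13 (p. 279) [Kato2004Asterisque]; R. Greenberg, Adv. Stud. Pure Math. 17 (1989) §0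
pp. 101–102 (`S^ι`, Thm. 2) [Greenberg1989]; R. Greenberg, LNM 1716 (1999) §1 p. 60 [GreenbergLNM1716];
L. Washington, GTM 83, §13.2 [Washington1997]; B. Mazur, J. Tate, J. Teitelbaum, Invent. Math. 84 (1986) Ch. I §17
[MazurTateTeitelbaum1986Invent]; tree: `IwasawaAlgebraInvolution.lean`, `IwasawaAlgebraInvolutionFixedPrimesProofs.lean`,
`IwasawaAlgebraSemilinearCharIdealProofs.lean`, `KatoFineSelmerDualUniquenessProofs.lean`, `Kato2004/IwasawaH2Descent.lean`,
`Kato2004/IwasawaH2FineSelmerDualComparison.lean`, `Kato2004/EulerSystemBoundFineSelmerContragredient.lean`.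
-/

noncomputable section

open scoped NumberField nonZeroDivisors
open Field
open Literature.NumberTheory.GaloisRepresentations
open Literature.NumberTheory.EllipticCurves Literature.NumberTheory.EllipticCurves.IwasawaAlgebra

namespace Literature.NumberTheory.EllipticCurves.Kato2004

universe u

/-! ## §1 Algebra of the involution on `Λ`-modules -/

section Algebra

variable {p : ℕ} [Fact p.Prime]

/-- `T + ι T + ι T · T = 0` in `Λ` (from `ι T · (1 + T) = −T`). [cite: Washington1997, §13.2] -/
theorem X_add_invol_X_add_mul :
    (PowerSeries.X : IwasawaAlgebra p) + invol p PowerSeries.X + invol p PowerSeries.X * PowerSeries.X = 0 := by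
  have h := invol_X_mul_one_add_X p
  linear_combination h

variable {M : Type*} [AddCommGroup M] [Module (IwasawaAlgebra p) M]

/-- On a `Λ`-module, `T m = 0 → (ι T) m = 0`. [cite: GreenbergLNM1716, §1 p. 60] -/
theorem invol_X_smul_eq_zero_of_X_smul_eq_zero {m : M} (h : (PowerSeries.X : IwasawaAlgebra p) • m = 0) :
    invol p PowerSeries.X • m = 0 := by
  have key : ((PowerSeries.X : IwasawaAlgebra p) + invol p PowerSeries.X +
      invol p PowerSeries.X * PowerSeries.X) • m = 0 := by
    rw [X_add_invol_X_add_mul, zero_smul]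
  rwa [add_smul, add_smul, mul_smul, h, smul_zero, zero_add, add_zero] at key

/-- On a `Λ`-module, `(ι T) m = 0 → T m = 0`. [cite: GreenbergLNM1716, §1 p. 60] -/
theorem X_smul_eq_zero_of_invol_X_smul_eq_zero {m : M} (h : invol p PowerSeries.X • m = 0) :
    (PowerSeries.X : IwasawaAlgebra p) • m = 0 := by
  have key : ((PowerSeries.X : IwasawaAlgebra p) + invol p PowerSeries.X +
      invol p PowerSeries.X * PowerSeries.X) • m = 0 := by
    rw [X_add_invol_X_add_mul, zero_smul]
  rwa [add_smul, add_smul, mul_comm, mul_smul, h, smul_zero, add_zero, add_zero] at key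

/-- `T m = 0 ↔ (ι T) m = 0`: the `T`-invariants of `M` and of `M^ι` coincide. [cite: GreenbergLNM1716, §1 p. 60] -/
theorem invol_X_smul_eq_zero_iff (m : M) :
    invol p PowerSeries.X • m = 0 ↔ (PowerSeries.X : IwasawaAlgebra p) • m = 0 :=
  ⟨X_smul_eq_zero_of_invol_X_smul_eq_zero, invol_X_smul_eq_zero_of_X_smul_eq_zero⟩

/-- On `M[T]` the action of `f ∈ Λ` depends only on `f(0)`: `T m = 0`, `f(0) = g(0)` ⇒ `f m = g m`.
[cite: Washington1997, §13.2] -/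
theorem smul_eq_smul_of_constantCoeff_eq {m : M} (hm : (PowerSeries.X : IwasawaAlgebra p) • m = 0)
    {f g : IwasawaAlgebra p} (hfg : PowerSeries.constantCoeff f = PowerSeries.constantCoeff g) :
    f • m = g • m := by
  have hmem : f - g ∈ Ideal.span ({PowerSeries.X} : Set (IwasawaAlgebra p)) := by
    rw [mem_span_X_iff_constantCoeff, map_sub, hfg, sub_self]
  obtain ⟨q, hq⟩ := Ideal.mem_span_singleton'.mp hmem
  have h2 : (f - g) • m = 0 := by rw [← hq, mul_smul, hm, smul_zero]
  rwa [sub_smul, sub_eq_zero] at h2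

/-- On `M[T]`, `ι f` acts as `f` (`(ι f)(0) = f(0)`). [cite: GreenbergLNM1716, §1 p. 60] -/
theorem invol_smul_eq_smul_of_X_smul_eq_zero {m : M} (hm : (PowerSeries.X : IwasawaAlgebra p) • m = 0)
    (f : IwasawaAlgebra p) : invol p f • m = f • m :=
  smul_eq_smul_of_constantCoeff_eq hm (constantCoeff_invol p f)

/-- `ι` preserves non-zero-divisors of `Λ` (a domain; `ι` injective). [cite: Washington1997, §13.2] -/
theorem invol_mem_nonZeroDivisors {a : IwasawaAlgebra p} (ha : a ∈ (IwasawaAlgebra p)⁰) :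
    invol p a ∈ (IwasawaAlgebra p)⁰ :=
  mem_nonZeroDivisors_of_ne_zero fun h ↦
    nonZeroDivisors.ne_zero ha (invol_injective p (by rw [h, map_zero]))

/-- The prime `ι𝔓 := PrimeSpectrum.comap (invol p) 𝔓` has the height of `𝔓` (`ι` is a ring automorphism).
[cite: Washington1997, §13.2] -/
theorem height_comap_invol (𝔓 : PrimeSpectrum (IwasawaAlgebra p)) :
    (PrimeSpectrum.comap (invol p).toRingHom 𝔓).asIdeal.height = 𝔓.asIdeal.height := by
  have h : PrimeSpectrum.comap (invol p).toRingHom 𝔓 =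
      ⟨𝔓.asIdeal.comap (involEquiv p : IwasawaAlgebra p ≃+* IwasawaAlgebra p), inferInstance⟩ := by
    apply PrimeSpectrum.ext
    ext f
    rw [PrimeSpectrum.comap_asIdeal, Ideal.mem_comap, Ideal.mem_comap]
    rfl
  rw [h]
  exact RingEquiv.height_comap _ _

/-- `ι(ι𝔓) = 𝔓`. [cite: Washington1997, §13.2] -/
theorem comap_invol_comap_invol (𝔓 : PrimeSpectrum (IwasawaAlgebra p)) :
    PrimeSpectrum.comap (invol p).toRingHom (PrimeSpectrum.comap (invol p).toRingHom 𝔓) = 𝔓 := by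
  apply PrimeSpectrum.ext
  ext f
  rw [PrimeSpectrum.comap_asIdeal, PrimeSpectrum.comap_asIdeal, Ideal.mem_comap, Ideal.mem_comap]
  change invol p (invol p f) ∈ 𝔓.asIdeal ↔ f ∈ 𝔓.asIdeal
  rw [invol_invol]

end Algebra

/-! ## §2 Transport along an `ι`-semilinear additive equivalence (`N = M^ι`) -/

section Transport

variable {p : ℕ} [Fact p.Prime]
  {M : Type*} [AddCommGroup M] [Module (IwasawaAlgebra p) M]
  {N : Type*} [AddCommGroup N] [Module (IwasawaAlgebra p) N]

/-- `M` finitely generated ⇒ `M^ι` finitely generated. [cite: Washington1997, §13.2] -/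
theorem finite_of_involSemilinear [Module.Finite (IwasawaAlgebra p) M] (e : M ≃+ N)
    (he : ∀ (f : IwasawaAlgebra p) (m : M), e (f • m) = invol p f • e m) :
    Module.Finite (IwasawaAlgebra p) N := by
  haveI : RingHomSurjective (invol p).toRingHom := ⟨(invol_bijective p).2⟩
  let φ : M →ₛₗ[(invol p).toRingHom] N :=
    { toFun := e
      map_add' := e.map_add
      map_smul' := he }
  exact Module.Finite.of_surjective φ e.surjective

/-- `M` torsion ⇒ `M^ι` torsion. [cite: Washington1997, §13.2] -/
theorem isTorsion_of_involSemilinear (hM : Module.IsTorsion (IwasawaAlgebra p) M) (e : M ≃+ N)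
    (he : ∀ (f : IwasawaAlgebra p) (m : M), e (f • m) = invol p f • e m) :
    Module.IsTorsion (IwasawaAlgebra p) N := by
  intro n
  obtain ⟨m, rfl⟩ := e.surjective n
  obtain ⟨⟨a, ha⟩, ham⟩ := @hM m
  refine ⟨⟨invol p a, invol_mem_nonZeroDivisors ha⟩, ?_⟩
  change invol p a • e m = 0
  rw [← he, show a • m = 0 from ham, map_zero]

/-- **`ℓ_𝔓(M^ι) = ℓ_{ι𝔓}(M)`** for `ι𝔓 = PrimeSpectrum.comap (invol p) 𝔓` (the tree's
`Module.lengthAt_eq_of_semilinearEquiv` for the ring automorphism `involEquiv p`, which is its own inverse).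
[cite: GreenbergLNM1716, §1 p. 60] [cite: BourbakiAC5to7, Ch. VII §4.4] -/
theorem lengthAt_eq_of_involSemilinear (e : M ≃+ N)
    (he : ∀ (f : IwasawaAlgebra p) (m : M), e (f • m) = invol p f • e m)
    (𝔓 : PrimeSpectrum (IwasawaAlgebra p)) :
    Module.lengthAt (IwasawaAlgebra p) N 𝔓 =
      Module.lengthAt (IwasawaAlgebra p) M (PrimeSpectrum.comap (invol p).toRingHom 𝔓) := by
  have h := Module.lengthAt_eq_of_semilinearEquiv
    (involEquiv p : IwasawaAlgebra p ≃+* IwasawaAlgebra p) e (fun r m ↦ he r m)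
    (PrimeSpectrum.comap (invol p).toRingHom 𝔓)
  rw [h]
  congr 1
  apply PrimeSpectrum.ext
  ext f
  rw [PrimeSpectrum.comapEquiv_apply, PrimeSpectrum.comap_asIdeal, PrimeSpectrum.comap_asIdeal,
    Ideal.mem_comap, Ideal.mem_comap]
  change f ∈ 𝔓.asIdeal ↔ invol p (invol p f) ∈ 𝔓.asIdeal
  rw [invol_invol]

end Transport

/-! ## §3 The `γ ↦ γ⁻¹` twist of a dual fine Selmer datum is its `ι`-twist -/

section FineTwist

variable {K : Type u} [Field K] [NumberField K] {W : WeierstrassCurve K} {p : ℕ} [Fact p.Prime]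
  {κ : ZpExtension K p} {γ δ : Field.absoluteGaloisGroup K}

/-- In `Y : W.FineSelmerDualData κ γ` the unit `ι(1 + T)` acts as `x ↦ x ∘ conj_δ` for `γ δ = 1`
(`(1 + T)` acts as `x ↦ x ∘ conj_γ` and `conj` is an action). Named-`ι` re-derivation of cell `bsd-wall`'s
`fine_toDual_invol_one_add_X_smul`. [cite: GreenbergLNM1716, §1 p. 60] -/
theorem fineSelmerDualData_toDual_invol_one_add_X_smul (hγδ : γ * δ = 1) (Y : W.FineSelmerDualData κ γ)
    (x : Y.X) (s : W.fineSelmerInfty κ) :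
    Y.toDual (invol p (1 + PowerSeries.X) • x) s =
      Y.toDual x ⟨W.conjH1 p κ.kerSubgroup δ s, W.conjH1_mem_fineSelmerInfty κ δ s.2⟩ := by
  set y : Y.X := invol p (1 + PowerSeries.X) • x with hy
  have hx : x = (1 + PowerSeries.X : IwasawaAlgebra p) • y := by
    rw [hy, ← mul_smul, one_add_X_mul_invol_one_add_X p, one_smul]
  have h1 : ∀ s' : W.fineSelmerInfty κ, Y.toDual ((1 + PowerSeries.X : IwasawaAlgebra p) • y) s' =
      Y.toDual y ⟨W.conjH1 p κ.kerSubgroup γ s', W.conjH1_mem_fineSelmerInfty κ γ s'.2⟩ := by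
    intro s'
    rw [add_smul, one_smul, map_add, AddMonoidHom.add_apply, Y.toDual_T_smul, add_sub_cancel]
  conv_rhs => rw [hx, h1]
  congr 1
  apply Subtype.ext
  change (s : W.subgroupH1 p κ.kerSubgroup) =
    W.conjH1 p κ.kerSubgroup γ (W.conjH1 p κ.kerSubgroup δ (s : W.subgroupH1 p κ.kerSubgroup))
  rw [← AddMonoidHom.comp_apply, ← W.conjH1_mul_holds p κ.kerSubgroup γ δ, hγδ,
    W.conjH1_one_holds p κ.kerSubgroup, AddMonoidHom.id_apply]

/-- **The `γ ↦ δ = γ⁻¹` twist of a dual fine Selmer datum is its `ι`-twist**: for `γ δ = 1` and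
`Y : W.FineSelmerDualData κ γ` there is `Y' : W.FineSelmerDualData κ δ` on the same character group with the
`Λ`-structure twisted by `ι` (an `ι`-semilinear `e : Y.X ≃+ Y'.X` over `toDual`). Named-`ι` Literature
re-derivation of `exists_twist_fineSelmerDualData_invol` (cell `bsd-wall`). [cite: GreenbergLNM1716, §1 p. 60]
[cite: Greenberg1989, §0 pp. 101–102] -/
theorem fineSelmerDualData_exists_involTwist (hγδ : γ * δ = 1) (Y : W.FineSelmerDualData κ γ) :
    ∃ (Y' : W.FineSelmerDualData κ δ) (e : Y.X ≃+ Y'.X),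
      (∀ (f : IwasawaAlgebra p) (x : Y.X), e (f • x) = invol p f • e x) ∧
      ∀ x : Y.X, Y'.toDual (e x) = Y.toDual x := by
  refine ⟨@WeierstrassCurve.FineSelmerDualData.mk K _ _ W p _ κ δ Y.X Y.addCommGroup
      (Module.compHom Y.X (invol p).toRingHom) Y.toDual Y.bijective ?_ ?_,
    AddEquiv.refl Y.X, ?_, ?_⟩
  · intro x s
    change Y.toDual (invol p PowerSeries.X • x) s = _
    have hX : invol p (PowerSeries.X : IwasawaAlgebra p) = invol p (1 + PowerSeries.X) - 1 := by
      rw [map_add, map_one, add_sub_cancel_left]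
    rw [hX, sub_smul, one_smul, map_sub, AddMonoidHom.sub_apply,
      fineSelmerDualData_toDual_invol_one_add_X_smul hγδ Y x s]
  · intro c x s k hk
    change Y.toDual (invol p (PowerSeries.C c) • x) s = _
    rw [invol_C]
    exact Y.toDual_C_smul c x s k hk
  · intro f x
    change f • x = invol p (invol p f) • x
    rw [invol_invol]
  · intro x
    rfl

/-- **`ℓ_𝔓(Y') = ℓ_{ι𝔓}(Y)` for ANY dual fine Selmer data `Y` of key `γ` and `Y'` of key `γ⁻¹`** (the twisted
datum of `fineSelmerDualData_exists_involTwist` has these lengths by `lengthAt_eq_of_involSemilinear`, and any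
two data of key `γ⁻¹` are `Λ`-isomorphic, `FineSelmerDualData.nonempty_linearEquiv`). In particular, with
`Y = W.fineSelmerDualData κ hγ` (the constructed key-`γ` datum `(X₀)^ι`) and `Y'` the contragredient `X₀`.
[cite: GreenbergLNM1716, §1 p. 60] [cite: Greenberg1989, §0 pp. 101–102] -/
theorem fineSelmerDualData_lengthAt_inv_eq (Y : W.FineSelmerDualData κ γ) (Y' : W.FineSelmerDualData κ γ⁻¹)
    (𝔓 : PrimeSpectrum (IwasawaAlgebra p)) :
    Module.lengthAt (IwasawaAlgebra p) Y'.X 𝔓 =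
      Module.lengthAt (IwasawaAlgebra p) Y.X (PrimeSpectrum.comap (invol p).toRingHom 𝔓) := by
  obtain ⟨Y₁, e, he, -⟩ := fineSelmerDualData_exists_involTwist (mul_inv_cancel γ) Y
  obtain ⟨e'⟩ := WeierstrassCurve.FineSelmerDualData.nonempty_linearEquiv Y' Y₁
  rw [Module.lengthAt_eq_of_linearEquiv e' 𝔓, lengthAt_eq_of_involSemilinear e he 𝔓]

/-- The same with the roles exchanged: `ℓ_𝔓(Y) = ℓ_{ι𝔓}(Y')` for `Y` of key `γ`, `Y'` of key `γ⁻¹`.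
[cite: GreenbergLNM1716, §1 p. 60] -/
theorem fineSelmerDualData_lengthAt_eq_inv (Y : W.FineSelmerDualData κ γ) (Y' : W.FineSelmerDualData κ γ⁻¹)
    (𝔓 : PrimeSpectrum (IwasawaAlgebra p)) :
    Module.lengthAt (IwasawaAlgebra p) Y.X 𝔓 =
      Module.lengthAt (IwasawaAlgebra p) Y'.X (PrimeSpectrum.comap (invol p).toRingHom 𝔓) := by
  rw [fineSelmerDualData_lengthAt_inv_eq Y Y', comap_invol_comap_invol]

end FineTwist

/-! ## §4 The `ι`-twist of Kato's `𝐇²`-package `IwasawaH2Data` -/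

section H2Twist

variable {W : WeierstrassCurve ℚ} [W.IsElliptic] {p : ℕ} [Fact p.Prime]
  [ContinuousSMul ℤ_[p] (W.tateModule p)] {κ : ZpExtension ℚ p} {γ : absoluteGaloisGroup ℚ}
  {I : IwasawaH1Data W p κ γ}

/-- **The `ι`-twist `J^ι` of a package `J : IwasawaH2Data W p κ γ I` is again a package over the SAME
`(κ, γ, I)`**: `H2 ↦ H2^ι` (same group, `Λ` acting through `ι`), `(A, toH1, ι)` unchanged, `π` unchanged as a
map of sets (`H2^ι[T] = H2[T]` and `Λ` acts on it through the augmentation, which `ι` preserves); finiteness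
(12.2.1), torsion (Thm. 12.4 (1)) and the exact sequence (14.14.1) with its pins transfer. Delivered as: an
`ι`-semilinear `e : J.H2 ≃+ J'.H2` and `ℓ_𝔓(J'.H2) = ℓ_{ι𝔓}(J.H2)` at every prime `𝔓`. So the hypothesis
structure cannot distinguish `𝐇²_Γ(T_pW)` from `𝐇²_Γ(T_pW)^ι`: which of the two a consumer means is fixed only
by a lengths comparison with a module of KNOWN convention (§5).
[cite: Kato2004Asterisque, §12.2 (12.2.1) (p. 220), Thm. 12.4 (1) (p. 221), §14.14 (14.14.1) (p. 243)]
[cite: Greenberg1989, §0 pp. 101–102] -/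
theorem IwasawaH2Data.exists_involTwist (J : IwasawaH2Data W p κ γ I) :
    ∃ (J' : IwasawaH2Data W p κ γ I) (e : J.H2 ≃+ J'.H2),
      (∀ (f : IwasawaAlgebra p) (x : J.H2), e (f • x) = invol p f • e x) ∧
      ∀ 𝔓 : PrimeSpectrum (IwasawaAlgebra p),
        Module.lengthAt (IwasawaAlgebra p) J'.H2 𝔓 =
          Module.lengthAt (IwasawaAlgebra p) J.H2 (PrimeSpectrum.comap (invol p).toRingHom 𝔓) := by
  -- every `J.π a` is killed by `T`, hence by `ι T`
  have hπ : ∀ a : J.A, (PowerSeries.X : IwasawaAlgebra p) • ((J.π a : invariants p J.H2) : J.H2) = 0 :=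
    fun a ↦ (mem_invariants_iff p J.H2 _).mp (J.π a).2
  -- the twisted package: `H2` with `Λ` acting through `ι`, everything else unchanged
  let J' : IwasawaH2Data W p κ γ I :=
    { H2 := J.H2
      addCommGroupH2 := J.addCommGroupH2
      moduleH2 := Module.compHom J.H2 (invol p).toRingHom
      finite_H2 := @finite_of_involSemilinear p _ J.H2 _ _ J.H2 _
        (Module.compHom J.H2 (invol p).toRingHom) J.finite_H2 (AddEquiv.refl J.H2)
        (fun f x ↦ by
          change f • x = invol p (invol p f) • x
          rw [invol_invol])
      isTorsion_H2 := @isTorsion_of_involSemilinear p _ J.H2 _ _ J.H2 _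
        (Module.compHom J.H2 (invol p).toRingHom) J.isTorsion_H2 (AddEquiv.refl J.H2)
        (fun f x ↦ by
          change f • x = invol p (invol p f) • x
          rw [invol_invol])
      A := J.A
      toH1 := J.toH1
      toH1_injective := J.toH1_injective
      mem_range_toH1_iff := J.mem_range_toH1_iff
      toH1_smul := J.toH1_smul
      ι := J.ι
      π :=
        { toFun := fun a ↦ ⟨((J.π a : invariants p J.H2) : J.H2), by
            change invol p PowerSeries.X • ((J.π a : invariants p J.H2) : J.H2) = 0
            exact invol_X_smul_eq_zero_of_X_smul_eq_zero (hπ a)⟩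
          map_add' := fun a b ↦ by
            apply Subtype.ext
            change ((J.π (a + b) : invariants p J.H2) : J.H2) =
              ((J.π a : invariants p J.H2) : J.H2) + ((J.π b : invariants p J.H2) : J.H2)
            rw [map_add]
            rfl
          map_smul' := fun f a ↦ by
            apply Subtype.ext
            change ((J.π (f • a) : invariants p J.H2) : J.H2) =
              invol p f • ((J.π a : invariants p J.H2) : J.H2)
            rw [map_smul, invol_smul_eq_smul_of_X_smul_eq_zero (hπ a)]
            rfl }
      ι_injective := J.ι_injective
      π_surjective := fun y ↦ by
        have hy := y.2
        change invol p PowerSeries.X • (y : J.H2) = 0 at hy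
        obtain ⟨a, ha⟩ := J.π_surjective
          ⟨(y : J.H2), (mem_invariants_iff p J.H2 _).mpr (X_smul_eq_zero_of_invol_X_smul_eq_zero hy)⟩
        exact ⟨a, Subtype.ext (congrArg Subtype.val ha :)⟩
      exact_ι_π := fun a ↦ by
        rw [← J.exact_ι_π a]
        constructor
        · intro h
          exact Subtype.ext (congrArg Subtype.val h :)
        · intro h
          exact Subtype.ext (congrArg Subtype.val h :)
      toH1_ι := J.toH1_ι }
  -- the identity of `J.H2` is `ι`-semilinear from the given structure to the twisted one
  let e : J.H2 ≃+ J'.H2 := AddEquiv.refl J.H2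
  have he : ∀ (f : IwasawaAlgebra p) (x : J.H2), e (f • x) = invol p f • e x := by
    intro f x
    change f • x = invol p (invol p f) • x
    rw [invol_invol]
  exact ⟨J', e, he, fun 𝔓 ↦ lengthAt_eq_of_involSemilinear e he 𝔓⟩

end H2Twist

/-! ## §5 The print-exact (contragredient) form of the (H2)-lengths comparison, from the named fact -/

section H2Contra

open WeierstrassCurve

/-- **Kato's `𝐇²_Γ(T_pW)` has the height-one lengths of the CONTRAGREDIENT dual fine Selmer group — derived
from the named fact `exists_iwasawaH2Data_fineSelmerDual_embedding` (0 new facts).** Under that fact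
(displayed as `h`), for `p ≠ 2`, `κ` cyclotomic, `v` the place at `p` and `W(ℚ_{p,∞})[p^∞]` finite: for every
pinned `I : IwasawaH1Data W p κ γ` and EVERY dual fine Selmer datum `Y : W.FineSelmerDualData κ γ⁻¹` of key
`γ⁻¹` — `X₀(W/ℚ_∞)` with `1 + T` acting as `x ↦ x ∘ conj_{γ⁻¹}`, the structure Poitou–Tate duality carries
Kato's natural action on `𝐇²(T_pW)₀` to — there is a package `J : IwasawaH2Data W p κ γ I` with
`ℓ_𝔮(J.H2) = ℓ_𝔮(Y.X)` at every height-one prime `𝔮` of `Λ`. Proof: the fact gives `J₁` with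
`ℓ(J₁.H2) = ℓ((X₀)_γ)` (`….lengthAt_eq`, key-`γ` datum `= (X₀)^ι`); take `J := J₁^ι` (§4) and use
`ℓ_𝔮(J₁^ι) = ℓ_{ι𝔮}(J₁) = ℓ_{ι𝔮}((X₀)_γ) = ℓ_𝔮(Y)` (§3; `ι𝔮` has height one). This is the (H2) clause of
`Summit…Additive.IsKatoZetaDescentDatumOf` in its print-exact keying (v3).
[cite: Kato2004Asterisque, (14.9.1) (p. 239), §12.2 (12.2.3) (p. 220), Thm. 12.4 (1) (p. 221), (14.14.1) (p. 243), (17.13.1) (p. 279)]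
[cite: Greenberg1989, §0 pp. 101–102] -/
theorem exists_iwasawaH2Data_fineSelmerDual_embedding.lengthAt_eq_contra
    (h : exists_iwasawaH2Data_fineSelmerDual_embedding)
    {W : WeierstrassCurve ℚ} [W.IsElliptic] {p : ℕ} [Fact p.Prime]
    [ContinuousSMul ℤ_[p] (W.tateModule p)] {κ : ZpExtension ℚ p} {γ : absoluteGaloisGroup ℚ}
    (hγ : κ.IsTopGenerator γ) (v : IsDedekindDomain.HeightOneSpectrum (𝓞 ℚ)) (hp : p ≠ 2)
    (hκ : κ.IsCyclotomic) (hv : ((Rat.HeightOneSpectrum.primesEquiv v : Nat.Primes) : ℕ) = p)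
    (hfin : Finite (FixedPoints.addSubgroup ↥(κ.kerSubgroup ⊓ GreenbergSelmer.decomp v)
      (W.geomPrimaryTorsion p)))
    (I : IwasawaH1Data W p κ γ) (Y : W.FineSelmerDualData κ γ⁻¹) :
    ∃ J : IwasawaH2Data W p κ γ I,
      ∀ 𝔮 : PrimeSpectrum (IwasawaAlgebra p), 𝔮.asIdeal.height = 1 →
        Module.lengthAt (IwasawaAlgebra p) J.H2 𝔮 = Module.lengthAt (IwasawaAlgebra p) Y.X 𝔮 := by
  obtain ⟨J₁, hJ₁⟩ := h.lengthAt_eq hγ v hp hκ hv hfin I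
  obtain ⟨J, e, he, hlen⟩ := J₁.exists_involTwist
  refine ⟨J, fun 𝔮 h𝔮 ↦ ?_⟩
  have h𝔮' : (PrimeSpectrum.comap (invol p).toRingHom 𝔮).asIdeal.height = 1 := by
    rw [height_comap_invol, h𝔮]
  rw [hlen 𝔮, hJ₁ _ h𝔮', ← fineSelmerDualData_lengthAt_inv_eq (W.fineSelmerDualData κ hγ) Y 𝔮]

end H2Contra

end Literature.NumberTheory.EllipticCurves.Kato2004

end
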